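import Mathlib.Data.Rat.Defs
import Mathlib.Data.Finset.Insert
import Mathlib.Algebra.Order.Field.Rat
import Mathlib.Algebra.BigOperators.Group.List.Basic
import Mathlib.LinearAlgebra.Matrix.Determinant.Basic
import Mathlib.Data.ZMod.Basic
import Mathlib.Tactic.Linarith
import Mathlib.Tactic.NormNum
import Mathlib.Tactic.NormNum.Prime
import Mathlib.Tactic.IntervalCases
import Mathlib.Tactic.Positivity
import Mathlib.Tactic.Ring
import HarnessLib

/-!
# Atlas arithmetic at `p = 11, 13`: the points `(11, 1/48)`, `(13, 1/56)`, the intervals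
# `(1/51, 1/48)`, `(1/57, 1/56)`, the F-point `(11, 2/99)`, and two elimination determinants
# (CARVER tasks T38, T39, T41)

INSTRUMENT, NOT a resolution theorem: the exact rational side-arithmetic behind THEOREM-L5N eng1-g36
§6.2–6.3 (the legal-class atlas `atlas36.py` at the four new places, the F-point lemma F_{2/9}(11),
and the Λ₅♮ / Λ₆ elimination constants) for ENGINE 1's polynomial weighted-centre TOY MODEL `W(f)`.
Genuine weights (value `1`); a slot weight `w` is *legal* iff it is dense (`0 < w ≤ 1/5`) or one of
the five `U`-points `{5/24, 2/9, 1/4, 1/3, 1/2}` (N, N′, W, M, V); `r` is the rate and a pure class of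
degree `j` weighs `j r` (the atlas lists degrees `j ≥ 2`; the statements below hold for every `j`).

Contents (every item closed arithmetic over `ℚ` / `ℕ`):
* T38 (points): `j/48` is legal iff `1 ≤ j ≤ 9` or `j ∈ {10, 12, 16, 24}` (N, W, M, V);
  `j/56` is legal iff `1 ≤ j ≤ 11` or `j ∈ {14, 28}` (W, V); the `K₁`-level facts at `(11, 1/48)`
  (`1 − 44/48 = 4/48 < 8/48`, `44 ∉ {24, 32, 40} ∪ {41, 45}`) and at `(13, 1/56)`, and the numeric
  hypotheses of the rules dispatched to (`6pρ > 1`, `p · 5ρ > 1`, `n < p`, the QP′ threshold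
  `ρ > 1/(4(p+3))`, the `S = 1` emitter bound).
* T38 (intervals): on `1/57 < r < 1/56` (`p = 13`), `j r` is legal iff `1 ≤ j ≤ 11` (no `U`-point is
  hit; every `j ≥ 12` is illegal); on `1/51 < r < 1/48` (`p = 11`), `j r` is dense-legal iff
  `1 ≤ j ≤ 9` or (`j = 10` and `r ≤ 1/50`), and `j r ∈ U` iff (`j = 11`, `r = 2/99`: the F-point on
  N′) or (`j = 25`, `r = 1/50`: V); breakpoints `1/51 < 1/50 < 2/99 < 1/48`; the `K₁` weight
  `1 − 4p·r` lies in `(4r, 7r)` resp. `(4r, 5r)`.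
* T39 (F-point `(11, 2/99)`): the legal weights `≥ 2/9` are exactly `{2/9, 1/4, 1/3, 1/2}`; a list of
  such weights sums to `7/9 = 1 − 2/9` iff it is a permutation of `[2/9, 2/9, 1/3]` (the pin-cofactor
  `M N′ N′`); and for every non-empty sub-multiset weight `wt κ ∈ {2/9, 1/3, 4/9, 5/9, 7/9}` and every
  order `s ≥ 1`, `wt κ + s · 2/99` is not legal (NO impure supplier) — proved for all `s ≥ 1`, which
  contains the range `1 ≤ s ≤ 11` of CARVER-NOTES T39; `4 ∤ 11` and `11 · 2/9 > 1`.
* T41: `det [[10, 6], [5, 4]] = 10`, `det [[20, 10, 4], [15, 10, 6], [6, 5, 4]] = 20` over `ℤ`, and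
  `10, 20` are non-zero in `ZMod p` for every prime `p ≥ 7`.

NOT a statement about the Abramovich–Temkin–Włodarczyk invariant; nothing here is summit progress;
AI-written, AI review weaker than expert review.  Reference (context only):
[AbramovichTemkinWlodarczyk2024] §5 (weights of a weighted centre).
-/

namespace Literature.AlgebraicGeometry.Resolution.WeightedBlowup

namespace Atlas1113

/-! ## The legal menu (genuine units) -/

/-- The five `U`-points N, N′, W, M, V of the legal menu (genuine units).
[cite: AbramovichTemkinWlodarczyk2024, §5] -/
def U : Finset ℚ := {5/24, 2/9, 1/4, 1/3, 1/2}

/-- A slot weight is legal iff it is dense (`0 < w ≤ 1/5`) or a `U`-point (= `atlas36.py`'s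
`legal`). [cite: AbramovichTemkinWlodarczyk2024, §5] -/
def Legal (w : ℚ) : Prop := (0 < w ∧ w ≤ 1/5) ∨ w ∈ U

/-- `Legal` is decidable (closed rational arithmetic). [cite: AbramovichTemkinWlodarczyk2024, §5] -/
instance instDecidablePredLegal : DecidablePred Legal :=
  fun _ => inferInstanceAs (Decidable ((_ ∧ _) ∨ _))

/-- Membership in `U`, unfolded. [cite: AbramovichTemkinWlodarczyk2024, §5] -/
theorem mem_U {w : ℚ} : w ∈ U ↔ w = 5/24 ∨ w = 2/9 ∨ w = 1/4 ∨ w = 1/3 ∨ w = 1/2 := by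
  simp [U]

/-- `Legal`, unfolded. [cite: AbramovichTemkinWlodarczyk2024, §5] -/
theorem legal_iff {w : ℚ} :
    Legal w ↔ (0 < w ∧ w ≤ 1/5) ∨ w = 5/24 ∨ w = 2/9 ∨ w = 1/4 ∨ w = 1/3 ∨ w = 1/2 := by
  rw [Legal, mem_U]

/-- A legal weight is positive and at most `1/2`. [cite: AbramovichTemkinWlodarczyk2024, §5] -/
theorem pos_and_le_half_of_legal {w : ℚ} (h : Legal w) : 0 < w ∧ w ≤ 1/2 := by
  rcases legal_iff.mp h with ⟨h0, h5⟩ | rfl | rfl | rfl | rfl | rfl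
  · exact ⟨h0, by linarith⟩
  all_goals norm_num

/-! ## T38 — the points `(11, 1/48)` and `(13, 1/56)` -/

/-- **Legal pure degrees at `(11, 1/48)`.** `j/48` is legal iff `1 ≤ j ≤ 9` (dense, `9/48 < 1/5 <
10/48`) or `j = 10` (N, `5/24`), `12` (W), `16` (M), `24` (V); `2/9` is not a multiple of `1/48`.
(The atlas lists `j ≥ 2`: `{2, …, 9, 10, 12, 16, 24}`.) [cite: AbramovichTemkinWlodarczyk2024, §5] -/
theorem point48_legal_iff (j : ℕ) :
    Legal ((j : ℚ) / 48) ↔ (1 ≤ j ∧ j ≤ 9) ∨ j = 10 ∨ j = 12 ∨ j = 16 ∨ j = 24 := by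
  rw [legal_iff]
  constructor
  · rintro (⟨h0, h5⟩ | h | h | h | h | h)
    · left
      have hj0 : 0 < j := by exact_mod_cast (show (0 : ℚ) < j by linarith)
      have hj9 : j < 10 := by exact_mod_cast (show (j : ℚ) < 10 by linarith)
      omega
    · right; left; exact_mod_cast (show (j : ℚ) = 10 by linarith)
    · exfalso
      have h3 : 3 * j = 32 := by exact_mod_cast (show (3 : ℚ) * j = 32 by linarith)
      omega
    · right; right; left; exact_mod_cast (show (j : ℚ) = 12 by linarith)
    · right; right; right; left; exact_mod_cast (show (j : ℚ) = 16 by linarith)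
    · right; right; right; right; exact_mod_cast (show (j : ℚ) = 24 by linarith)
  · rintro (⟨hj1, hj9⟩ | rfl | rfl | rfl | rfl)
    · left
      have h1' : (1 : ℚ) ≤ j := by exact_mod_cast hj1
      have h9' : (j : ℚ) ≤ 9 := by exact_mod_cast hj9
      constructor <;> linarith
    all_goals norm_num

/-- **Legal pure degrees at `(13, 1/56)`.** `j/56` is legal iff `1 ≤ j ≤ 11` (dense, `11/56 < 1/5 <
12/56`) or `j = 14` (W), `28` (V); `5/24, 2/9, 1/3` are not multiples of `1/56`.  (Atlas list:
`{2, …, 11, 14, 28}`.) [cite: AbramovichTemkinWlodarczyk2024, §5] -/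
theorem point56_legal_iff (j : ℕ) :
    Legal ((j : ℚ) / 56) ↔ (1 ≤ j ∧ j ≤ 11) ∨ j = 14 ∨ j = 28 := by
  rw [legal_iff]
  constructor
  · rintro (⟨h0, h5⟩ | h | h | h | h | h)
    · left
      have hj0 : 0 < j := by exact_mod_cast (show (0 : ℚ) < j by linarith)
      have hj11 : j < 12 := by exact_mod_cast (show (j : ℚ) < 12 by linarith)
      omega
    · exfalso
      have h3 : 3 * j = 35 := by exact_mod_cast (show (3 : ℚ) * j = 35 by linarith)
      omega
    · exfalso
      have h9 : 9 * j = 112 := by exact_mod_cast (show (9 : ℚ) * j = 112 by linarith)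
      omega
    · right; left; exact_mod_cast (show (j : ℚ) = 14 by linarith)
    · exfalso
      have h3 : 3 * j = 56 := by exact_mod_cast (show (3 : ℚ) * j = 56 by linarith)
      omega
    · right; right; exact_mod_cast (show (j : ℚ) = 28 by linarith)
  · rintro (⟨hj1, hj11⟩ | rfl | rfl)
    · left
      have h1' : (1 : ℚ) ≤ j := by exact_mod_cast hj1
      have h11' : (j : ℚ) ≤ 11 := by exact_mod_cast hj11
      constructor <;> linarith
    all_goals norm_num

/-- The same two lists by evaluation of the decidable predicate on `j ≤ 28` (cross-check of the
closed forms above; `atlas36.log` J-lists). [cite: AbramovichTemkinWlodarczyk2024, §5] -/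
theorem points_table :
    (List.range 29).filter (fun j => decide (Legal ((j : ℚ) / 48))) =
        [1, 2, 3, 4, 5, 6, 7, 8, 9, 10, 12, 16, 24] ∧
      (List.range 29).filter (fun j => decide (Legal ((j : ℚ) / 56))) =
        [1, 2, 3, 4, 5, 6, 7, 8, 9, 10, 11, 14, 28] := by
  constructor <;> decide +kernel

/-- **`K₁`-level and weight facts at `(11, 1/48)`** (THEOREM-L5N §6.2 (b), configuration `(3,4)`,
least third class `M` or `V`): the `K₁` level `4p = 44` is none of the pure levels `24` (VV),
`32` (MMM), `40` (M·V·T₈) nor `41, 45` (the `R′` levels); `K₁` weighs `1 − 44/48 = 4/48 < 8/48`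
(linear, at the boundary `ρ = 1/(4(p+1))`); `11, 15` are illegal degrees and `R′` weighs
`15/48 < 1/3`. [cite: AbramovichTemkinWlodarczyk2024, §5] -/
theorem point48_K1_facts :
    (44 : ℕ) ∉ ({24, 32, 40} : Finset ℕ) ∧ (44 : ℕ) ∉ ({24, 32, 40, 41, 45} : Finset ℕ) ∧
      2 * 12 = 24 ∧ 2 * 16 = 32 ∧ 16 + 24 = 40 ∧ 4 * 11 = 44 ∧
      (1 : ℚ) - 44/48 = 4/48 ∧ (1 : ℚ) - 44/48 < 8/48 ∧ (1 : ℚ)/48 = 1/(4 * (11 + 1)) ∧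
      ¬ Legal ((11 : ℚ)/48) ∧ ¬ Legal ((15 : ℚ)/48) ∧ (15 : ℚ)/48 < 1/3 := by
  refine ⟨by decide, by decide, rfl, rfl, rfl, rfl, by norm_num, by norm_num, by norm_num,
    by decide +kernel, by decide +kernel, by norm_num⟩

/-- **`K₁` facts at `(13, 1/56)`**: level `4p = 52 ≠ 28` (the only pure level when `P = {V}`),
`K₁` weighs `1 − 52/56 = 4/56` (boundary `1/(4(p+1))`), `13/56` illegal.
[cite: AbramovichTemkinWlodarczyk2024, §5] -/
theorem point56_K1_facts :
    (52 : ℕ) ≠ 28 ∧ 4 * 13 = 52 ∧ (1 : ℚ) - 52/56 = 4/56 ∧ (1 : ℚ) - 52/56 < 8/56 ∧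
      (1 : ℚ)/56 = 1/(4 * (13 + 1)) ∧ ¬ Legal ((13 : ℚ)/56) := by
  refine ⟨by decide, rfl, by norm_num, by norm_num, by norm_num, by decide +kernel⟩

/-- **Numeric hypotheses of the rules dispatched to at the two points** (THEOREM-L5N §6.2): `6pρ > 1`
(`66/48`, `78/56`); `1/(6ρ) < p` (`8 < 11`, `56/6 < 13`); FQ (i) normal form `ρ > 1/(8p)`; the QP′
pin-triple threshold `ρ > 1/(4(p+3))` (`1/56`, `1/64`); third classes `j₃ ≥ 5`: `p · 5ρ > 1`
(`55/48`, `65/56`) with `n = ⌊1/(10ρ)⌋ = 4` resp. `5` `< p`; the `S = 1` emitter bound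
`(4p + 1)ρ > 1/2` (`45/48`, `53/56`); the W-third-class band value `p/4 > 1`.
[cite: AbramovichTemkinWlodarczyk2024, §5] -/
theorem points_rule_hypotheses :
    (66 : ℚ)/48 > 1 ∧ (78 : ℚ)/56 > 1 ∧ (48 : ℚ)/6 < 11 ∧ (56 : ℚ)/6 < 13 ∧
      (1 : ℚ)/48 > 1/(8 * 11) ∧ (1 : ℚ)/56 > 1/(8 * 13) ∧
      (1 : ℚ)/48 > 1/(4 * (11 + 3)) ∧ (1 : ℚ)/56 > 1/(4 * (13 + 3)) ∧
      (55 : ℚ)/48 > 1 ∧ (65 : ℚ)/56 > 1 ∧ (48 / 10 : ℕ) = 4 ∧ (56 / 10 : ℕ) = 5 ∧ 4 < 11 ∧ 5 < 13 ∧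
      (45 : ℚ)/48 > 1/2 ∧ (53 : ℚ)/56 > 1/2 ∧ (11 : ℚ)/4 > 1 ∧ (13 : ℚ)/4 > 1 := by
  norm_num

/-! ## T38 — the intervals `1/57 < r < 1/56` (`p = 13`) and `1/51 < r < 1/48` (`p = 11`) -/

/-- Degree bounds from `j r = u > 0` on `(1/57, 1/56)`: `56u < j < 57u`. (derived here)
[cite: AbramovichTemkinWlodarczyk2024, §5] -/
theorem degree_bounds56 {r : ℚ} (h1 : 1/57 < r) (h2 : r < 1/56) {j u : ℚ} (hj : 0 < j)
    (h : j * r = u) : 56 * u < j ∧ j < 57 * u := by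
  have p1 := mul_pos hj (show (0 : ℚ) < 1/56 - r by linarith)
  have p2 := mul_pos hj (show (0 : ℚ) < r - 1/57 by linarith)
  constructor
  · nlinarith [p1]
  · nlinarith [p2]

/-- Degree bounds from `j r = u > 0` on `(1/51, 1/48)`: `48u < j < 51u`. (derived here)
[cite: AbramovichTemkinWlodarczyk2024, §5] -/
theorem degree_bounds48 {r : ℚ} (h1 : 1/51 < r) (h2 : r < 1/48) {j u : ℚ} (hj : 0 < j)
    (h : j * r = u) : 48 * u < j ∧ j < 51 * u := by
  have p1 := mul_pos hj (show (0 : ℚ) < 1/48 - r by linarith)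
  have p2 := mul_pos hj (show (0 : ℚ) < r - 1/51 by linarith)
  constructor
  · nlinarith [p1]
  · nlinarith [p2]

/-- **`p = 13` on `(1/57, 1/56)`: dense degrees.** `0 < j r ≤ 1/5` iff `1 ≤ j ≤ 11`
(`11 r < 11/56 < 1/5 < 12/57 < 12 r`). [cite: AbramovichTemkinWlodarczyk2024, §5] -/
theorem interval56_dense_iff {r : ℚ} (h1 : 1/57 < r) (h2 : r < 1/56) (j : ℕ) :
    (0 < (j : ℚ) * r ∧ (j : ℚ) * r ≤ 1/5) ↔ 1 ≤ j ∧ j ≤ 11 := by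
  have hr : 0 < r := by linarith
  constructor
  · rintro ⟨hpos, hle⟩
    constructor
    · rcases Nat.eq_zero_or_pos j with rfl | hj
      · simp at hpos
      · exact hj
    · rcases le_or_gt j 11 with hj | hj
      · exact hj
      · exfalso
        have h12 : (12 : ℚ) ≤ j := by exact_mod_cast (show 12 ≤ j by omega)
        have : 12 * r ≤ (j : ℚ) * r := mul_le_mul_of_nonneg_right h12 hr.le
        linarith
  · rintro ⟨hj1, hj11⟩
    have hj1' : (1 : ℚ) ≤ j := by exact_mod_cast hj1
    have hj11' : (j : ℚ) ≤ 11 := by exact_mod_cast hj11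
    constructor
    · exact mul_pos (by linarith) hr
    · have : (j : ℚ) * r ≤ 11 * r := mul_le_mul_of_nonneg_right hj11' hr.le
      linarith

/-- **`p = 13` on `(1/57, 1/56)`: no `U`-point is hit.** `j r ∉ U` for every `j`
(`56u < j < 57u` has no integer solution for `u ∈ U`: the windows are `(11⅔, 11⅞)`, `(12.4, 12.7)`,
`(14, 14¼)`, `(18⅔, 19)`, `(28, 28½)`). [cite: AbramovichTemkinWlodarczyk2024, §5] -/
theorem interval56_not_mem_U {r : ℚ} (h1 : 1/57 < r) (h2 : r < 1/56) (j : ℕ) :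
    (j : ℚ) * r ∉ U := by
  rw [mem_U]
  have hj : (0 : ℚ) < j ∨ (j : ℚ) = 0 := by
    rcases Nat.eq_zero_or_pos j with rfl | hj
    · right; simp
    · left; exact_mod_cast hj
  rcases hj with hj | hj
  · rintro (h | h | h | h | h) <;> obtain ⟨ha, hb⟩ := degree_bounds56 h1 h2 hj h
    · have hlo : 11 < j := by exact_mod_cast (show (11 : ℚ) < j by linarith)
      have hhi : j < 12 := by exact_mod_cast (show (j : ℚ) < 12 by linarith)
      omega
    · have hlo : 12 < j := by exact_mod_cast (show (12 : ℚ) < j by linarith)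
      have hhi : j < 13 := by exact_mod_cast (show (j : ℚ) < 13 by linarith)
      omega
    · have hlo : 14 < j := by exact_mod_cast (show (14 : ℚ) < j by linarith)
      have hhi : j < 15 := by exact_mod_cast (show (j : ℚ) < 15 by linarith)
      omega
    · have hlo : 18 < j := by exact_mod_cast (show (18 : ℚ) < j by linarith)
      have hhi : j < 19 := by exact_mod_cast (show (j : ℚ) < 19 by linarith)
      omega
    · have hlo : 28 < j := by exact_mod_cast (show (28 : ℚ) < j by linarith)
      have hhi : j < 29 := by exact_mod_cast (show (j : ℚ) < 29 by linarith)
      omega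
  · rw [hj]; norm_num

/-- **`p = 13` on `(1/57, 1/56)`: legal pure degrees are exactly `1 ≤ j ≤ 11`** (atlas: `{2, …, 11}`,
one cell, no interior breakpoint); in particular every `j ≥ 12` (`12`, `13 = p`, `14`, `28`, …) is
illegal. [cite: AbramovichTemkinWlodarczyk2024, §5] -/
theorem interval56_legal_iff {r : ℚ} (h1 : 1/57 < r) (h2 : r < 1/56) (j : ℕ) :
    Legal ((j : ℚ) * r) ↔ 1 ≤ j ∧ j ≤ 11 := by
  unfold Legal
  rw [interval56_dense_iff h1 h2]
  exact ⟨fun h => h.resolve_right (interval56_not_mem_U h1 h2 j), Or.inl⟩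

/-- Corollary: on `(1/57, 1/56)` every degree `j ≥ 12` is illegal (the form asked for in
CARVER-NOTES T38). [cite: AbramovichTemkinWlodarczyk2024, §5] -/
theorem interval56_illegal_of_ge {r : ℚ} (h1 : 1/57 < r) (h2 : r < 1/56) (j : ℕ) (hj : 12 ≤ j) :
    ¬ Legal ((j : ℚ) * r) := by
  rw [interval56_legal_iff h1 h2]; omega

/-- **`p = 11` on `(1/51, 1/48)`: dense degrees.** `0 < j r ≤ 1/5` iff `1 ≤ j ≤ 9` or (`j = 10` and
`r ≤ 1/50`) (`9 r < 9/48 < 1/5`; `10 r ≤ 1/5 ↔ r ≤ 1/50`; `11 r > 11/51 > 1/5`).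
[cite: AbramovichTemkinWlodarczyk2024, §5] -/
theorem interval48_dense_iff {r : ℚ} (h1 : 1/51 < r) (h2 : r < 1/48) (j : ℕ) :
    (0 < (j : ℚ) * r ∧ (j : ℚ) * r ≤ 1/5) ↔ (1 ≤ j ∧ j ≤ 9) ∨ (j = 10 ∧ r ≤ 1/50) := by
  have hr : 0 < r := by linarith
  constructor
  · rintro ⟨hpos, hle⟩
    have hj1 : 1 ≤ j := by
      rcases Nat.eq_zero_or_pos j with rfl | hj
      · simp at hpos
      · exact hj
    have hj10 : j ≤ 10 := by
      rcases le_or_gt j 10 with hj | hj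
      · exact hj
      · exfalso
        have h11 : (11 : ℚ) ≤ j := by exact_mod_cast (show 11 ≤ j by omega)
        have : 11 * r ≤ (j : ℚ) * r := mul_le_mul_of_nonneg_right h11 hr.le
        linarith
    rcases Nat.lt_or_ge j 10 with hj | hj
    · left; omega
    · right
      obtain rfl : j = 10 := le_antisymm hj10 hj
      refine ⟨rfl, ?_⟩
      push_cast at hle
      linarith
  · rintro (⟨hj1, hj9⟩ | ⟨rfl, h50⟩)
    · have hj1' : (1 : ℚ) ≤ j := by exact_mod_cast hj1
      have hj9' : (j : ℚ) ≤ 9 := by exact_mod_cast hj9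
      constructor
      · exact mul_pos (by linarith) hr
      · have : (j : ℚ) * r ≤ 9 * r := mul_le_mul_of_nonneg_right hj9' hr.le
        linarith
    · push_cast
      constructor <;> linarith

/-- **`p = 11` on `(1/51, 1/48)`: the `U`-hits.** `j r ∈ U` iff (`j = 11` and `r = 2/99`: `11 r = 2/9`,
the F-point on the class N′) or (`j = 25` and `r = 1/50`: `25 r = 1/2`, V); the windows
`48u < j < 51u` are `(10, 10⅝)`, `(10⅔, 11⅓)`, `(12, 12¾)`, `(16, 17)`, `(24, 25½)`.
[cite: AbramovichTemkinWlodarczyk2024, §5] -/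
theorem interval48_mem_U_iff {r : ℚ} (h1 : 1/51 < r) (h2 : r < 1/48) (j : ℕ) :
    (j : ℚ) * r ∈ U ↔ (j = 11 ∧ r = 2/99) ∨ (j = 25 ∧ r = 1/50) := by
  rw [mem_U]
  have hj : (0 : ℚ) < j ∨ (j : ℚ) = 0 := by
    rcases Nat.eq_zero_or_pos j with rfl | hj
    · right; simp
    · left; exact_mod_cast hj
  constructor
  · rcases hj with hj | hj
    · rintro (h | h | h | h | h) <;> obtain ⟨ha, hb⟩ := degree_bounds48 h1 h2 hj h
      · have hlo : 10 < j := by exact_mod_cast (show (10 : ℚ) < j by linarith)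
        have hhi : j < 11 := by exact_mod_cast (show (j : ℚ) < 11 by linarith)
        omega
      · have hlo : 10 < j := by exact_mod_cast (show (10 : ℚ) < j by linarith)
        have hhi : j < 12 := by exact_mod_cast (show (j : ℚ) < 12 by linarith)
        obtain rfl : j = 11 := by omega
        left; exact ⟨rfl, by push_cast at h; linarith⟩
      · have hlo : 12 < j := by exact_mod_cast (show (12 : ℚ) < j by linarith)
        have hhi : j < 13 := by exact_mod_cast (show (j : ℚ) < 13 by linarith)
        omega
      · have hlo : 16 < j := by exact_mod_cast (show (16 : ℚ) < j by linarith)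
        have hhi : j < 17 := by exact_mod_cast (show (j : ℚ) < 17 by linarith)
        omega
      · have hlo : 24 < j := by exact_mod_cast (show (24 : ℚ) < j by linarith)
        have hhi : j < 26 := by exact_mod_cast (show (j : ℚ) < 26 by linarith)
        obtain rfl : j = 25 := by omega
        right; exact ⟨rfl, by push_cast at h; linarith⟩
    · rw [hj]; norm_num
  · rintro (⟨rfl, rfl⟩ | ⟨rfl, rfl⟩) <;> norm_num

/-- **`p = 11` on `(1/51, 1/48)`: legal pure degrees** = `{1, …, 9} ∪ {10 iff r ≤ 1/50} ∪
{11 iff r = 2/99} ∪ {25 iff r = 1/50}` (atlas breakpoints `1/50`, `2/99`; five cells).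
[cite: AbramovichTemkinWlodarczyk2024, §5] -/
theorem interval48_legal_iff {r : ℚ} (h1 : 1/51 < r) (h2 : r < 1/48) (j : ℕ) :
    Legal ((j : ℚ) * r) ↔
      (1 ≤ j ∧ j ≤ 9) ∨ (j = 10 ∧ r ≤ 1/50) ∨ (j = 11 ∧ r = 2/99) ∨ (j = 25 ∧ r = 1/50) := by
  unfold Legal
  rw [interval48_dense_iff h1 h2, interval48_mem_U_iff h1 h2]
  exact or_assoc

/-- The special rates of the `p = 11` interval, sorted, and the F-point identities:
`1/51 < 1/50 < 2/99 < 1/48`, `11 · (2/99) = 2/9`, `25 · (1/50) = 1/2`, `10 · (1/50) = 1/5`.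
[cite: AbramovichTemkinWlodarczyk2024, §5] -/
theorem interval48_breakpoints :
    (1/51 : ℚ) < 1/50 ∧ (1/50 : ℚ) < 2/99 ∧ (2/99 : ℚ) < 1/48 ∧ (11 : ℚ) * (2/99) = 2/9 ∧
      (25 : ℚ) * (1/50) = 1/2 ∧ (10 : ℚ) * (1/50) = 1/5 := by
  norm_num

/-- **Numeric hypotheses of the dispatched rules on the two intervals** (THEOREM-L5N §6.3):
`p = 13`, `1/57 < r < 1/56`: the `K₁` weight `1 − 52r ∈ (4r, 5r)` (dense, linear), `65 r > 1`
(T9 D for `j ≥ 5`), `78 r > 1` (`6pρ > 1`), `60 r > 1` (`n ≤ 5 < 13`), `r > 1/64` (QP′), `r > 1/104`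
(normal form), `53 r > 1/2` (`S = 1`), `8 · 13 r > 1` hence no pin-triples for `j* = 4`;
`p = 11`, `1/51 < r < 1/48`: `1 − 44r ∈ (4r, 7r)` and `1 − 44 r < 8 r` (`r > 1/52`), `55 r > 1`,
`66 r > 1`, `60 r > 1` (`n ≤ 5 < 11`), `r > 1/56` (QP′), `r > 1/88`, `45 r > 1/2`.
[cite: AbramovichTemkinWlodarczyk2024, §5] -/
theorem intervals_rule_hypotheses :
    (∀ r : ℚ, 1/57 < r → r < 1/56 →
      4 * r < 1 - 52 * r ∧ 1 - 52 * r < 5 * r ∧ 1 - 52 * r ≤ 1/5 ∧ 1 < 65 * r ∧ 1 < 78 * r ∧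
        1 < 60 * r ∧ 1/64 < r ∧ 1/104 < r ∧ 1/2 < 53 * r ∧ 1 < 8 * (13 * r)) ∧
    (∀ r : ℚ, 1/51 < r → r < 1/48 →
      4 * r < 1 - 44 * r ∧ 1 - 44 * r < 7 * r ∧ 1 - 44 * r < 8 * r ∧ 1 - 44 * r ≤ 1/5 ∧
        1 < 55 * r ∧ 1 < 66 * r ∧ 1 < 60 * r ∧ 1/56 < r ∧ 1/88 < r ∧ 1/2 < 45 * r) := by
  constructor
  · intro r h1 h2
    refine ⟨by linarith, by linarith, by linarith, by linarith, by linarith, by linarith,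
      by linarith, by linarith, by linarith, by linarith⟩
  · intro r h1 h2
    refine ⟨by linarith, by linarith, by linarith, by linarith, by linarith, by linarith,
      by linarith, by linarith, by linarith, by linarith⟩

/-! ## T39 — the F-point `(11, 2/99)` (LEMMA F_{2/9}(11)) -/

/-- **`T`-variables at the F-point.** The legal weights `≥ 2/9` are exactly the `U`-points
`2/9, 1/4, 1/3, 1/2` (N′, W, M, V): no dense weight exceeds `1/5`, and `5/24 < 2/9`.
[cite: AbramovichTemkinWlodarczyk2024, §5] -/
theorem legal_ge_two_ninths_iff (w : ℚ) :
    (Legal w ∧ 2/9 ≤ w) ↔ w = 2/9 ∨ w = 1/4 ∨ w = 1/3 ∨ w = 1/2 := by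
  rw [legal_iff]
  constructor
  · rintro ⟨⟨h0, h5⟩ | h | h | h | h | h, hw⟩
    · exfalso; linarith
    · exfalso; rw [h] at hw; norm_num at hw
    · exact Or.inl h
    · exact Or.inr (Or.inl h)
    · exact Or.inr (Or.inr (Or.inl h))
    · exact Or.inr (Or.inr (Or.inr h))
  · rintro (rfl | rfl | rfl | rfl) <;> norm_num

/-- A list of weights `≥ 2/9` summing to `7/9` has at most three members. (derived here)
[cite: AbramovichTemkinWlodarczyk2024, §5] -/
theorem length_le_three_of_sum {l : List ℚ} (hl : ∀ x ∈ l, 2/9 ≤ x) (hs : l.sum = 7/9) :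
    l.length ≤ 3 := by
  have key : ∀ l : List ℚ, (∀ x ∈ l, 2/9 ≤ x) → 2/9 * (l.length : ℚ) ≤ l.sum := by
    intro l
    induction l with
    | nil => intro _; simp
    | cons a l ih =>
      intro h
      simp only [List.sum_cons, List.length_cons, Nat.cast_add, Nat.cast_one]
      have ha := h a (by simp)
      have := ih (fun x hx => h x (by simp [hx]))
      linarith
  have h := key l hl
  rw [hs] at h
  have : (l.length : ℚ) < 4 := by linarith
  have : l.length < 4 := by exact_mod_cast this
  omega

set_option maxHeartbeats 800000 in
/-- **The pin-cofactors of the F-class are `M N′ N′` only.** A list of legal weights `≥ 2/9` (i.e. of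
`U`-weights `2/9, 1/4, 1/3, 1/2`) sums to `7/9 = 1 − 2/9` iff it is a permutation of
`[2/9, 2/9, 1/3]` (`f29p11.py` / `fpointU36.py`: "t = MN′N′ only").
[cite: AbramovichTemkinWlodarczyk2024, §5] -/
theorem pinCofactor_iff (l : List ℚ) (hl : ∀ x ∈ l, Legal x ∧ 2/9 ≤ x) :
    l.sum = 7/9 ↔ l.Perm [2/9, 2/9, 1/3] := by
  constructor
  · intro hs
    have hl' : ∀ x ∈ l, x = 2/9 ∨ x = 1/4 ∨ x = 1/3 ∨ x = 1/2 :=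
      fun x hx => (legal_ge_two_ninths_iff x).mp (hl x hx)
    have hlen := length_le_three_of_sum (fun x hx => (hl x hx).2) hs
    rcases l with _ | ⟨a, _ | ⟨b, _ | ⟨c, _ | ⟨d, l⟩⟩⟩⟩
    · norm_num at hs
    · rcases hl' a (by simp) with rfl | rfl | rfl | rfl <;> norm_num at hs
    · rcases hl' a (by simp) with rfl | rfl | rfl | rfl <;>
        rcases hl' b (by simp) with rfl | rfl | rfl | rfl <;> norm_num at hs
    · rcases hl' a (by simp) with rfl | rfl | rfl | rfl <;>
        rcases hl' b (by simp) with rfl | rfl | rfl | rfl <;>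
          rcases hl' c (by simp) with rfl | rfl | rfl | rfl <;>
            first | (norm_num at hs; done) | decide +kernel
    · simp only [List.length_cons] at hlen; omega
  · intro hp
    rw [hp.sum_eq]; norm_num

/-- **NO impure supplier at the F-point** (LEMMA F_{2/9}(11), census `f29p11.py`, `fpointU36.py`):
for every non-empty sub-multiset `κ` of the pin-cofactor `M N′ N′` — weights
`wt κ ∈ {2/9, 1/3, 4/9, 5/9, 7/9}` — and every order `s ≥ 1`, the would-be supplier weight
`wt κ + s · (2/99)` is NOT legal (it exceeds `1/5`, and `99 (u − wt κ)/2 ∈ {1.375, 5.5, 13.75, 8.25,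
2.75}` is never a positive integer).  Proved for all `s ≥ 1` (CARVER-NOTES T39 asks `1 ≤ s ≤ 11`).
[cite: AbramovichTemkinWlodarczyk2024, §5] -/
theorem fpoint99_no_supplier (w : ℚ) (hw : w = 2/9 ∨ w = 1/3 ∨ w = 4/9 ∨ w = 5/9 ∨ w = 7/9)
    (s : ℕ) (hs : 1 ≤ s) : ¬ Legal (w + s * (2/99)) := by
  intro hL
  have hs' : (1 : ℚ) ≤ s := by exact_mod_cast hs
  obtain ⟨-, hle⟩ := pos_and_le_half_of_legal hL
  have hw9 : 2/9 ≤ w := by rcases hw with rfl | rfl | rfl | rfl | rfl <;> norm_num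
  have hs13 : s ≤ 13 := by
    have : (s : ℚ) < 14 := by linarith
    have : s < 14 := by exact_mod_cast this
    omega
  rcases hw with rfl | rfl | rfl | rfl | rfl <;> interval_cases s <;>
    exact absurd hL (by decide +kernel)

/-- The sub-multiset weights of `M N′ N′ = [1/3, 2/9, 2/9]`: the non-empty sublists have sums
`{2/9, 1/3, 4/9, 5/9, 7/9}` (cross-check of the list used in `fpoint99_no_supplier`).
[cite: AbramovichTemkinWlodarczyk2024, §5] -/
theorem pinCofactor_subweights :
    ∀ κ ∈ ([1/3, 2/9, 2/9] : List ℚ).sublists, κ ≠ [] →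
      κ.sum = 2/9 ∨ κ.sum = 1/3 ∨ κ.sum = 4/9 ∨ κ.sum = 5/9 ∨ κ.sum = 7/9 := by
  decide +kernel

/-- Remaining F-point arithmetic (THEOREM-L5N §6.3): the F-class weighs `11 · (2/99) = 2/9` (N′) and
`ε_f^{11}` has value `11 · (2/9) > 1`; the only other unrectified pure degree is `4` and `4 ∤ 11`
(no pure-only active set); the earlier classes weigh `3 · 2/99, 4 · 2/99 < 1/5` (dense).
[cite: AbramovichTemkinWlodarczyk2024, §5] -/
theorem fpoint99_facts :
    (11 : ℚ) * (2/99) = 2/9 ∧ (1 : ℚ) < 11 * (2/9) ∧ (∀ m : ℕ, 4 * m ≠ 11) ∧ ¬ (4 ∣ 11) ∧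
      Legal (3 * (2/99)) ∧ Legal (4 * (2/99)) ∧ (4 : ℚ) * (2/99) < 1/5 ∧ (1 : ℚ) - 2/9 = 7/9 := by
  refine ⟨by norm_num, by norm_num, fun m => by omega, by decide, by decide +kernel,
    by decide +kernel, by norm_num, by norm_num⟩

/-! ## T41 — the Λ₅♮ / Λ₆ elimination determinants -/

/-- `det [[10, 6], [5, 4]] = 10` over `ℤ` (the Λ₅♮ elimination constant).
[cite: AbramovichTemkinWlodarczyk2024, §5] -/
theorem det_lambda5 : Matrix.det !![(10 : ℤ), 6; 5, 4] = 10 := by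
  norm_num [Matrix.det_fin_two_of]

/-- `det [[20, 10, 4], [15, 10, 6], [6, 5, 4]] = 20` over `ℤ` (the Λ₆ elimination constant).
[cite: AbramovichTemkinWlodarczyk2024, §5] -/
theorem det_lambda6 : Matrix.det !![(20 : ℤ), 10, 4; 15, 10, 6; 6, 5, 4] = 20 := by
  rw [Matrix.det_fin_three]; decide

/-- The constants `10` and `20` (and the binomials `4, 5, 6, 15`) are non-zero in `ZMod p` for every
prime `p ≥ 7`. [cite: AbramovichTemkinWlodarczyk2024, §5] -/
theorem det_consts_ne_zero (p : ℕ) (hp : p.Prime) (h7 : 7 ≤ p) :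
    (10 : ZMod p) ≠ 0 ∧ (20 : ZMod p) ≠ 0 ∧ (4 : ZMod p) ≠ 0 ∧ (5 : ZMod p) ≠ 0 ∧
      (6 : ZMod p) ≠ 0 ∧ (15 : ZMod p) ≠ 0 := by
  have key : ∀ n : ℕ, (n = 4 ∨ n = 5 ∨ n = 6 ∨ n = 10 ∨ n = 15 ∨ n = 20) →
      ((n : ℕ) : ZMod p) = 0 → False := by
    rintro n hn h
    have hd : p ∣ n := (ZMod.natCast_eq_zero_iff n p).mp h
    rcases hn with rfl | rfl | rfl | rfl | rfl | rfl
    all_goals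
      have hle := Nat.le_of_dvd (by norm_num) hd
      first
        | omega
        | (interval_cases p <;> first | (norm_num at hp; done) | norm_num at hd)
  refine ⟨fun h => key 10 (by norm_num) (by exact_mod_cast h),
    fun h => key 20 (by norm_num) (by exact_mod_cast h),
    fun h => key 4 (by norm_num) (by exact_mod_cast h),
    fun h => key 5 (by norm_num) (by exact_mod_cast h),
    fun h => key 6 (by norm_num) (by exact_mod_cast h),
    fun h => key 15 (by norm_num) (by exact_mod_cast h)⟩

end Atlas1113

end Literature.AlgebraicGeometry.Resolution.WeightedBlowup
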